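import Summits.BirchSwinnertonDyer.Rank1Residual.X11b.Three.HsiehDescentOfReciprocity
import Summits.BirchSwinnertonDyer.Rank1Residual.X11b.PadicSemiInvariant
import Summits.BirchSwinnertonDyer.Rank1Residual.X11b.UnramifiedInertiaFixed
import HarnessLib

/-!
# X11b @ `p = 3`, S29 K4 + K3: the descent node from VALUE RECIPROCITY alone

HONEST FRAMING (cell `b2b-bsdres`, run/shared/lean/b2b/bsd-rank1-residual/, verbatim in every
file): the goal of the cell is to DELETE the COMBINATION-SHAPED residual classes of the
Birch–Swinnerton-Dyer formula for ALL analytic-rank `≤ 1` elliptic curves over `ℚ` — assembled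
STRICTLY from published theorems — so that the rank-`≤ 1` remainder becomes exactly the
CONSTRUCTION-SHAPED classes, which are TYPED, NOT attempted. This is not "finishing BSD". Team N8/O2
(X11b at `3`); deal S29 (x11b3-lead GEN 8, OWNERS R9-8/R9-30/R9-41), packages K4 (x11b3-p7) + K3
(x11b3-p1, x11b3-p5, x11b3-p2, x11b3-p3), seat `b2b-bsdres-x11b3-p7` (gen. 5). **WORDING OF RECORD
(H45, R9-8): S29 RE-EXPRESSES (t) ⟸ (VR).** This file plugs the two K3 TREE THEOREMS
(`PadicSemiInvariant.apply_eq_zero_of_forall_exists_semiInvariant`, x11b3-p1: local Kronecker–Weber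
+ Lang + Tate, every `p`; `UnramifiedInertia.apply_symm_eq_of_forall_rootsOfUnity_of_ramificationIdx_eq_one`,
x11b3-p5: a number field unramified above `p` is fixed through `ι⁻¹` by inertia) into K4's
`hsiehDescentAt₃_of_valueReciprocity`, leaving EXACTLY ONE hypothesis: `hVR`, the planner's
`K4InlineShape` antecedent (x11b3-r1 v3) VERBATIM — an ASSEMBLED consequence of printed theorems
(BDP13 Thm. 5.5 / Brooks Prop. 8.7 + Shimura–Katz CM reciprocity, lit1 L72), NOT itself a printed
numbered statement, hence a LABELLED HYPOTHESIS and NOT a Literature fact. CONDITIONAL theorem; the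
node `Three.HsiehDescentAt₃` is UNCHANGED (no `_holds`, nothing appended); O2 OPEN / N8 CONSTRUCTION;
nothing booked; no mark / label / count / tier moved. THEOREMS ONLY (no definition, no named fact,
no `sorry`).

## What this file proves

* **`hsiehDescentAt₃_of_valueReciprocity'` : `hVR → HsiehDescentAt₃ W`** — (t) ⟸ (VR) at `p = 3`.

References: [Hsieh2014] Thm. 1; [CastellaHsieh2018] Def. 3.5; [Tate1967] §3.3; [SerreLocalFields1979]
III §5; cell files OWNERS R9-8 … R9-50.
-/

noncomputable section

open scoped NumberField
open NumberField IsDedekindDomain Field WeierstrassCurve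
open Literature.NumberTheory.GaloisRepresentations Literature.NumberTheory.EllipticCurves
open Literature.NumberTheory.EllipticCurves.ModularForms

namespace Summit.BirchSwinnertonDyer.Rank1Residual.X11b.Three

variable (W : WeierstrassCurve ℚ) [W.IsElliptic]

/-- **S29: `HsiehDescentAt₃ W` from value reciprocity (VR) alone** — K4's
`hsiehDescentAt₃_of_valueReciprocity` with its `p`-adic inputs `hSen`, `hUnr` DISCHARGED by the K3
tree theorems of x11b3-p1 / x11b3-p5 (under the local-field structure theorem
`Padic.isNonarchimedeanLocalField_holds 3`). The one remaining hypothesis `hVR` is x11b3-r1's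
`K4InlineShape` antecedent verbatim ((VR-A) cocycle clause on `Aut(ℂ/K)`, (VR-B) exactness on
`Aut(ℂ/F)` for some number field `F ⊇ K` unramified above `3`) — a labelled hypothesis, not a fact.
WORDING OF RECORD: S29 RE-EXPRESSES (t) ⟸ (VR). [cite: Hsieh2014, Thm. 1 (arXiv:1112.1580 pp. 3–4)]
[cite: CastellaHsieh2018, Def. 3.5 and Prop. 3.6] [cite: Tate1967, §3.3 Theorem 2] -/
theorem hsiehDescentAt₃_of_valueReciprocity'
    (hVR :
  (∀ (K : Type) [Field K] [NumberField K] (𝔭 : HeightOneSpectrum (𝓞 K)) {N : ℕ} [NeZero N]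
      (f : CuspForm (CongruenceSubgroup.Gamma0 N) 2),
      IsNewformOf W f → W.conductorNorm ℤ = N → IsImaginaryQuadratic K → SatisfiesHeegnerHypothesis N K →
      ((Ideal.span {(3 : ℤ)}).primesOver (𝓞 K)).ncard = 2 → ((3 : ℕ) : 𝓞 K) ∈ 𝔭.asIdeal →
      ∃ Ω : ℂ, Ω ≠ 0 ∧
        -- (VR-A) cocycle clause on Aut(ℂ/K); ideal slot = integer-exponent monomial at primes v ∤ 3 (F-i)
        (∀ σ : ℂ ≃ₐ[ℚ] ℂ, (∀ (φ : K →+* ℂ) (k : K), σ (φ k) = φ k) →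
          ∃ (c d : ℂ) (e : HeightOneSpectrum (𝓞 K) →₀ ℤ), c ≠ 0 ∧ d ≠ 0 ∧
            (∀ v ∈ e.support, ((3 : ℕ) : 𝓞 K) ∉ v.asIdeal) ∧
            ∀ (χ : HeckeCharacter K) (n : ℕ), 0 < n →
              (∀ v : HeightOneSpectrum (𝓞 K), χ.IsUnramifiedAt v) →
              ∀ hχ : χ.HasInfinityType (fun _ ↦ (n : ℤ)) (fun _ ↦ -(n : ℤ)),
                σ (bdpInterpolationValue 3 f 𝔭 χ n Ω) =
                  d * c ^ n * (e.prod fun v k ↦ (hχ.autConj σ).valueAtUniformizer v ^ k) *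
                    bdpInterpolationValue 3 f 𝔭 (hχ.autConj σ) n Ω) ∧
        -- (VR-B) exactness clause on Aut(ℂ/F), F ⊇ K a number field unramified above 3
        (∃ F : IntermediateField ℚ ℂ, FiniteDimensional ℚ F ∧
          (∀ (φ : K →+* ℂ) (k : K), φ k ∈ F) ∧
          (∀ P : Ideal (𝓞 F), P.IsPrime → ((3 : ℕ) : 𝓞 F) ∈ P → P.ramificationIdx (𝓞 ℚ) = 1) ∧
          ∀ σ : ℂ ≃ₐ[ℚ] ℂ, (∀ x : ℂ, x ∈ F → σ x = x) →
            ∀ (χ : HeckeCharacter K) (n : ℕ), 0 < n →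
              (∀ v : HeightOneSpectrum (𝓞 K), χ.IsUnramifiedAt v) →
              ∀ hχ : χ.HasInfinityType (fun _ ↦ (n : ℤ)) (fun _ ↦ -(n : ℤ)),
                σ (bdpInterpolationValue 3 f 𝔭 χ n Ω) =
                  bdpInterpolationValue 3 f 𝔭 (hχ.autConj σ) n Ω))) :
    HsiehDescentAt₃ W := by
  haveI : IsNonarchimedeanLocalField ℚ_[3] :=
    Literature.NumberTheory.GaloisRepresentations.Padic.isNonarchimedeanLocalField_holds 3
  exact hsiehDescentAt₃_of_valueReciprocity W hVR
    (fun T hT hTτ a hadd hcont H τ hτ ↦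
      PadicSemiInvariant.apply_eq_zero_of_forall_exists_semiInvariant T hT hTτ a hadd hcont H τ hτ)
    (UnramifiedInertia.apply_symm_eq_of_forall_rootsOfUnity_of_ramificationIdx_eq_one 3)

end Summit.BirchSwinnertonDyer.Rank1Residual.X11b.Three
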